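import Literature.Combinatorics.Optimization.NeighborlyObstructionBlockPsdLifts
import HarnessLib

/-!
# Polars of `(S^d_+)^r`-lifted convex bodies are `(S^d_+)^r`-lifted (Gouveia–Parrilo–Thomas 2013, Prop. 2.8 (2); Averkov 2019, (2.2))

J. Gouveia, P. A. Parrilo, R. R. Thomas, *Lifts of convex sets and cone factorizations*, Math. Oper. Res. 38
(2013) = arXiv:1111.3164 [cite: GouveiaParriloThomas2013] (held: `paper:arxiv-1111.3164`), Proposition 2.8:
"If `C_1` and `C_2` are convex bodies, and `K_1` and `K_2` are closed convex cones such that `C_1` has a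
`K_1`-lift … then … (2) `C_1°` has a `K_1^*`-lift" ("an immediate consequence of Theorem 2.4"), with
`C° = {y : ⟨x, y⟩ ≤ 1 ∀ x ∈ C}` (p05). G. Averkov 2019 [cite: Averkov2019], (2.2) p05: "`sxd(C^*) = sxd(C)`"
(the semidefinite extension degree is invariant under duality; `(S^k_+)^m` is self-dual, §3.2 p08).
Everything here is PROVED; no facts are asserted.

* `HasBlockPsdLift.dotProduct_polar` — for `K = (S^d_+)^r` (self-dual) and a BOUNDED set `C ⊆ ℝ^V` whose
  dot-product polar `{y : x ⬝ᵥ y ≤ 1 ∀ x ∈ C}` is bounded (e.g. a convex body with `0` in its interior): the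
  polar has an `(S^d_+)^r`-lift. Proof exactly as printed: the tree's "lift ⇒ factorization" theorem
  `HasBlockPsdLift.hasPsdPowerFactorization_slack` factorizes `1 − ⟨x, y⟩` on `C × C°` through `(S^d_+)^r`,
  the transposed factorization (`HasPsdPowerFactorization.transpose`) is one of the slack of `C°` against the
  inequalities `⟨x, ·⟩ ≤ 1`, `x ∈ C`, and "factorization ⇒ lift"
  (`HasPsdPowerFactorization.exists_hasBlockPsdLift_between`) returns a lifted set squeezed between
  `conv(C°)` and `{y : ⟨x, y⟩ ≤ 1 ∀ x ∈ C} = C°`. The one-block case is the tree's `HasPsdLift.polar`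
  (`ConvexBodyPsdLiftFactorization.lean`, inner-product form); here the dot product of `ℝ^V` is used, matching
  `BlockPsdLiftFactorization.lean`.
* `hasBlockPsdLift_zero_singleton` — `{0}` has every `(S^d_+)^r`-lift (used for the degenerate blocks).

Not here: the cone version `sxd(C^*) = sxd(C)` for closed convex cones (Averkov (2.1)/(2.2) via Thm. 19 and
Remark 20's reduction to pointed full-dimensional cones), and Prop. 2.8 (6) (`conv(C_1 ∪ C_2)`, which needs the
bipolar theorem in this dot-product setting).
-/

noncomputable section

open Finset Matrix
open scoped MatrixOrder

namespace Literature.Combinatorics.Optimization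

open FixedSizePsdRank (HasPsdPowerFactorization)

/-- `{0}` has an `(S^d_+)^r`-lift for all `d, r` (the zero map on the whole cone).
[cite: GouveiaParriloThomas2013, Def. 2.2 (§2)] -/
theorem hasBlockPsdLift_zero_singleton {E : Type*} [AddCommGroup E] [Module ℝ E] (d r : ℕ) :
    HasBlockPsdLift ({0} : Set E) d r := by
  refine ⟨⊤, 0, ?_⟩
  ext y
  simp only [Set.mem_singleton_iff, Set.mem_image, Set.mem_setOf_eq, LinearMap.zero_apply]
  constructor
  · rintro rfl
    exact ⟨0, ⟨fun _ => PosSemidef.zero, AffineSubspace.mem_top ℝ _ _⟩, rfl⟩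
  · rintro ⟨_, -, rfl⟩; rfl

/-- **GPT 2013 Prop. 2.8 (2) for `K = (S^d_+)^r` / Averkov 2019 (2.2) for convex bodies: the polar of an
`(S^d_+)^r`-lifted bounded set is `(S^d_+)^r`-lifted** — if `C ⊆ ℝ^V` is bounded, has an `(S^d_+)^r`-lift, and
its polar `C° = {y : x ⬝ᵥ y ≤ 1 ∀ x ∈ C}` is bounded, then `C°` has an `(S^d_+)^r`-lift ("`C_1°` has a
`K_1^*`-lift"; `(S^d_+)^r` is self-dual). [cite: GouveiaParriloThomas2013, Prop. 2.8 (2) (§2, p06)]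
[cite: Averkov2019, (2.2) (p05) and §3.2 (p08)] -/
theorem HasBlockPsdLift.dotProduct_polar {V : Type*} [Fintype V] {C : Set (V → ℝ)} {d r : ℕ}
    (hC : HasBlockPsdLift C d r) (hCb : Bornology.IsBounded C)
    (hPb : Bornology.IsBounded {y : V → ℝ | ∀ x ∈ C, x ⬝ᵥ y ≤ 1}) :
    HasBlockPsdLift {y : V → ℝ | ∀ x ∈ C, x ⬝ᵥ y ≤ 1} d r := by
  classical
  set P : Set (V → ℝ) := {y | ∀ x ∈ C, x ⬝ᵥ y ≤ 1} with hP
  -- degenerate blocks: `C ⊆ {0}`, so `P = ℝ^V` is bounded only if `V` is empty, and then `P = {0}`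
  by_cases h0 : d = 0 ∨ r = 0
  · have hC0 : C ⊆ {0} := hC.subset_zero_of_eq_zero h0
    have hPuniv : P = Set.univ := Set.eq_univ_of_forall fun y x hx => by
      rw [Set.mem_singleton_iff.1 (hC0 hx), zero_dotProduct]; exact zero_le_one
    have hV : IsEmpty V := by
      by_contra hne
      rw [not_isEmpty_iff] at hne
      obtain ⟨i⟩ := hne
      obtain ⟨R, hR⟩ := isBounded_iff_forall_norm_le.mp hPb
      have h1 := hR (fun _ => |R| + 1) (by rw [hPuniv]; exact Set.mem_univ _)
      have h3 : |R| + 1 ≤ ‖(fun _ : V => |R| + 1)‖ := by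
        have := norm_le_pi_norm (fun _ : V => |R| + 1) i
        rwa [Real.norm_eq_abs, abs_of_pos (by positivity)] at this
      linarith [le_abs_self R]
    have hP0 : P = {0} := by
      rw [hPuniv]
      exact Set.eq_singleton_iff_unique_mem.2 ⟨trivial, fun y _ => funext fun i => isEmptyElim i⟩
    rw [hP0]
    exact hasBlockPsdLift_zero_singleton d r
  push Not at h0
  have hd : 1 ≤ d := Nat.one_le_iff_ne_zero.2 h0.1
  have hr : 1 ≤ r := Nat.one_le_iff_ne_zero.2 h0.2
  -- the slack `1 − ⟨x, y⟩` on `C × C°` factorizes through `(S^d_+)^r` (Thm. 2.4 ⇒)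
  have hfac : HasPsdPowerFactorization (fun (x : C) (y : P) => (1 : ℝ) - (y : V → ℝ) ⬝ᵥ (x : V → ℝ)) d r :=
    hC.hasPsdPowerFactorization_slack (x := fun x : C => (x : V → ℝ)) (a := fun y : P => (y : V → ℝ))
      (b := fun _ => (1 : ℝ)) hd hr hCb (fun x => x.2) (fun z hz y => by rw [dotProduct_comm]; exact y.2 z hz)
  -- transposed: a factorization of the slack of `C°` against the inequalities `⟨x, ·⟩ ≤ 1`, `x ∈ C`
  have hfac' : HasPsdPowerFactorization (fun (y : P) (x : C) => (1 : ℝ) - (x : V → ℝ) ⬝ᵥ (y : V → ℝ)) d r := by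
    obtain ⟨A, B, hA, hB, hS⟩ := hfac
    refine ⟨B, A, hB, hA, fun y x => ?_⟩
    have h := hS x y
    simp only at h ⊢
    rw [dotProduct_comm, h]
    exact sum_congr rfl fun t _ => Matrix.trace_mul_comm _ _
  -- factorization ⇒ a lifted set between `conv(C°)` and `{y : ⟨x, y⟩ ≤ 1 ∀ x ∈ C} = C°` (Thm. 2.4 ⇐)
  have hQ : {z : V → ℝ | ∀ x : C, (x : V → ℝ) ⬝ᵥ z ≤ 1} = P := by
    ext z
    simp only [Set.mem_setOf_eq, Subtype.forall, hP]
  obtain ⟨C', hconv, hC'Q, hlift⟩ := hfac'.exists_hasBlockPsdLift_between hd hr (by rw [hQ]; exact hPb)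
  have hPC' : P ⊆ C' := fun y hy => hconv (subset_convexHull ℝ _ ⟨⟨y, hy⟩, rfl⟩)
  have hC'P : C' ⊆ P := hC'Q.trans hQ.le
  rwa [Set.Subset.antisymm hC'P hPC'] at hlift

end Literature.Combinatorics.Optimization

end
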